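import Mathlib
import HarnessLib
import Summits.Ventures.LatticeQCDFlow.Exactness.PopulationLeaveOneOutExact
import Summits.Ventures.LatticeQCDFlow.Exactness.MetropolisHastingsDensityKernel

/-!
# LatticeQCDFlow / Exactness — LEARNING ON THE JOB, XIV: THE PARAMETERS AS A WALKER — self-adaptation that reads the current configuration
# IS exact when the parameter update is itself a valid Monte Carlo move for a fixed parameter law (Metropolised retraining)

HONEST FRAMING: exact (Metropolis-corrected) sampling algorithms for lattice gauge theory;
figures of merit are autocorrelation/cost numbers at stated couplings and volumes; no
continuum-physics claim.

Venture `LatticeQCDFlow` (cell pub-lqcd), topic `Exactness`, FANOUT row 30 (lean-1 GEN-44, theme LEARNING ON THE JOB).  NEW WORK of the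
cell; no definition is introduced, nothing is cited as a fact.  Tree inputs: `PopulationLeaveOneOutExact` (the two-block leave-one-out sweep),
`MetropolisHastingsDensityKernel` (`metropolisHastings_invariant`).  The exact way to "learn from the configuration you are at": give the
parameters a target law `m` of their own and update them by a kernel that, for each frozen configuration, leaves `m` invariant — the
parameters are then one more walker of `PopulationLeaveOneOutExact`, and the configuration's marginal is `π` exactly.  `SelfTunedFlowChoiceBias`
is the degenerate case `h := F(x)` (a deterministic fit), whose sections preserve no fixed `m`.  Printed counterparts NAMED ONLY: auxiliary-
variable ∕ "Bayesian" adaptive MCMC (the parameter as a state variable with a pseudo-prior), Metropolised parameter moves in adaptive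
direction sampling (Gilks–Roberts–George 1994).

## Setting
Configuration space `Ω` with target `π`; parameter space `H` with a chosen probability law `m` (a pseudo-prior over flows); the flow sampler
`κ : Kernel (H × Ω) Ω` with `π`-exact frozen sections; a RETRAINING MOVE `τ : Kernel (Ω × H) H` that reads the configuration and, for each
frozen configuration, leaves `m` invariant (`hτ`) — e.g. propose `h' ∼ g(x, h, ·)` (a gradient step from the current configuration plus noise,
a fit to the current configuration) and accept with the Hastings ratio for `m` (§2).  Joint state `(h, x) ∈ H × Ω`, target `m ⊗ π`.

## Results (no `sorry`)
* §1 **`auxWalker_sweep_invariant`** — retrain (reading `x`), then sample (reading the new `h`): the sweep leaves `m ⊗ π` invariant;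
  **`auxWalker_sweep_invariant_symm`** — the other order; `auxWalker_retrain_invariant` ∕ `auxWalker_sample_invariant` — each half alone.
  Hence at stationarity the configuration is EXACTLY `π`-distributed although every retraining step read the current configuration.
* §2 **`metropolisedRetraining_sections_exact`** — a retraining move that proposes from any positive density `g((x, h), ·)` against a
  reference `λ_H` and accepts with `min(1, m(h')g((x, h'), h)/(m(h)g((x, h), h')))` has `m`-exact sections (`m = p_H·λ_H`), so §1 applies:
  **`metropolisedRetraining_sweep_invariant`**.
* §3 `deterministicFit_sections_exact_iff` — the deterministic fit `τ(x, h) = δ_{F(x)}` has `m`-exact sections iff `m = δ_{F(x)}` for every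
  `x`; so unless the fit ignores the configuration there is no pseudo-prior making it exact — the content of `SelfTunedFlowChoiceBias`.
-/

namespace Summit.Ventures.LatticeQCDFlow.Exactness

open MeasureTheory ProbabilityTheory
open scoped _root_.ENNReal

variable {Ω H : Type*} [MeasurableSpace Ω] [MeasurableSpace H] {π : Measure Ω} {m : Measure H}

/-! ## §1 The parameters as a walker: the retrain-then-sample sweep is exact for `m ⊗ π` -/

/-- **THE RETRAINING HALF-SWEEP IS EXACT**: moving the parameters by a kernel whose frozen-configuration sections preserve `m` leaves
`m ⊗ π` invariant. [ours] -/
theorem auxWalker_retrain_invariant [SFinite m] [SFinite π] (τ : Kernel (Ω × H) H)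
    (hτ : ∀ (x : Ω) {C : Set H}, MeasurableSet C → ∫⁻ h, τ (x, h) C ∂m = m C) (T₁ : Kernel (H × Ω) (H × Ω))
    (hT₁ : ∀ (h : H) (x : Ω) {E : Set (H × Ω)}, MeasurableSet E → T₁ (h, x) E = τ (x, h) ((fun h' => (h', x)) ⁻¹' E)) :
    Kernel.Invariant T₁ (m.prod π) :=
  leaveOneOut_fst_invariant τ hτ T₁ hT₁

/-- **THE SAMPLING HALF-SWEEP IS EXACT**: moving the configuration by the flow sampler with the current (frozen) parameters leaves `m ⊗ π`
invariant. [ours] -/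
theorem auxWalker_sample_invariant [SFinite π] (κ : Kernel (H × Ω) Ω)
    (hκ : ∀ (h : H) {B : Set Ω}, MeasurableSet B → ∫⁻ x, κ (h, x) B ∂π = π B) (T₂ : Kernel (H × Ω) (H × Ω))
    (hT₂ : ∀ (h : H) (x : Ω) {E : Set (H × Ω)}, MeasurableSet E → T₂ (h, x) E = κ (h, x) ((fun y => (h, y)) ⁻¹' E)) :
    Kernel.Invariant T₂ (m.prod π) :=
  leaveOneOut_snd_invariant κ hκ T₂ hT₂

/-- **SELF-ADAPTATION AS A TWO-WALKER SWEEP IS EXACT**: retrain reading the configuration, then sample reading the new parameters —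
`T₂ ∘ₖ T₁` leaves `m ⊗ π` invariant; in particular the configuration's marginal at stationarity is exactly `π`. [ours] -/
theorem auxWalker_sweep_invariant [SFinite m] [SFinite π] (τ : Kernel (Ω × H) H) (κ : Kernel (H × Ω) Ω)
    (hτ : ∀ (x : Ω) {C : Set H}, MeasurableSet C → ∫⁻ h, τ (x, h) C ∂m = m C)
    (hκ : ∀ (h : H) {B : Set Ω}, MeasurableSet B → ∫⁻ x, κ (h, x) B ∂π = π B) (T₁ T₂ : Kernel (H × Ω) (H × Ω))
    (hT₁ : ∀ (h : H) (x : Ω) {E : Set (H × Ω)}, MeasurableSet E → T₁ (h, x) E = τ (x, h) ((fun h' => (h', x)) ⁻¹' E))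
    (hT₂ : ∀ (h : H) (x : Ω) {E : Set (H × Ω)}, MeasurableSet E → T₂ (h, x) E = κ (h, x) ((fun y => (h, y)) ⁻¹' E)) :
    Kernel.Invariant (T₂ ∘ₖ T₁) (m.prod π) :=
  leaveOneOut_sequential_invariant τ κ hτ hκ T₁ T₂ hT₁ hT₂

/-- … and in the other order (sample first, then retrain on the new configuration). [ours] -/
theorem auxWalker_sweep_invariant_symm [SFinite m] [SFinite π] (τ : Kernel (Ω × H) H) (κ : Kernel (H × Ω) Ω)
    (hτ : ∀ (x : Ω) {C : Set H}, MeasurableSet C → ∫⁻ h, τ (x, h) C ∂m = m C)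
    (hκ : ∀ (h : H) {B : Set Ω}, MeasurableSet B → ∫⁻ x, κ (h, x) B ∂π = π B) (T₁ T₂ : Kernel (H × Ω) (H × Ω))
    (hT₁ : ∀ (h : H) (x : Ω) {E : Set (H × Ω)}, MeasurableSet E → T₁ (h, x) E = τ (x, h) ((fun h' => (h', x)) ⁻¹' E))
    (hT₂ : ∀ (h : H) (x : Ω) {E : Set (H × Ω)}, MeasurableSet E → T₂ (h, x) E = κ (h, x) ((fun y => (h, y)) ⁻¹' E)) :
    Kernel.Invariant (T₁ ∘ₖ T₂) (m.prod π) :=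
  leaveOneOut_sequential_invariant_symm τ κ hτ hκ T₁ T₂ hT₁ hT₂

/-- The configuration marginal of `m ⊗ π` is `π` (for a probability pseudo-prior): exactness of the sweep for `m ⊗ π` is exactness for the
configurations. [ours, bookkeeping] -/
theorem auxWalker_marginal_snd [IsProbabilityMeasure m] [SFinite π] : (m.prod π).map Prod.snd = π := by
  rw [Measure.map_snd_prod, measure_univ, one_smul]

/-! ## §2 Metropolised retraining has `m`-exact sections -/

section Metropolised

variable {lamH : Measure H} [SFinite lamH] {pH : H → ℝ} {g : Ω × H → H → ℝ}

/-- **METROPOLISED RETRAINING**: pseudo-prior `m = p_H·λ_H` with `p_H > 0`; from `(x, h)` propose `h' ∼ g((x, h), ·)λ_H` (any positive density,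
reading the configuration: a noisy gradient step, a noisy fit) and accept with `min(1, p_H(h')g((x, h'), h)/(p_H(h)g((x, h), h')))`.  For every
frozen configuration this is a Metropolis–Hastings kernel for `m`, so its sections are `m`-exact. [ours — `metropolisHastings_invariant` per section] -/
theorem metropolisedRetraining_sections_exact (hpH : Measurable pH) (hpH0 : ∀ h, 0 < pH h) (hg : Measurable (Function.uncurry g))
    (hg0 : ∀ z h', 0 < g z h') (τ : Kernel (Ω × H) H) [IsMarkovKernel τ]
    (hτ : ∀ (x : Ω) (h : H) {C : Set H}, MeasurableSet C → τ (x, h) C =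
      ∫⁻ h' in C, ENNReal.ofReal (g (x, h) h' * min 1 (pH h' * g (x, h') h / (pH h * g (x, h) h'))) ∂lamH +
        (1 - ∫⁻ h', ENNReal.ofReal (g (x, h) h' * min 1 (pH h' * g (x, h') h / (pH h * g (x, h) h'))) ∂lamH) * C.indicator 1 h)
    (x : Ω) {C : Set H} (hC : MeasurableSet C) :
    ∫⁻ h, τ (x, h) C ∂(lamH.withDensity fun h => ENNReal.ofReal (pH h)) = (lamH.withDensity fun h => ENNReal.ofReal (pH h)) C := by
  -- the frozen-configuration section is a Metropolis–Hastings kernel for `m` with proposal density `κ_x(h, h') = g((x, h), h')`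
  have hκx : Measurable (Function.uncurry fun h h' : H => g (x, h) h') :=
    hg.comp ((measurable_const.prodMk measurable_fst).prodMk measurable_snd)
  haveI : IsMarkovKernel (τ.comap (Prod.mk x) measurable_prodMk_left) := by
    refine ⟨fun h => ⟨?_⟩⟩
    rw [Kernel.comap_apply]
    exact measure_univ
  have hinv := metropolisHastings_invariant (μ := lamH) (κ := fun h h' : H => g (x, h) h') hpH hpH0 hκx (fun h h' => hg0 _ _)
    (τ.comap (Prod.mk x) measurable_prodMk_left) (fun h C hC => by rw [Kernel.comap_apply]; exact hτ x h hC)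
  have := congrArg (fun μ : Measure H => μ C) hinv.def
  simpa only [Measure.bind_apply hC (Kernel.aemeasurable _), Kernel.comap_apply] using this

/-- **… SO METROPOLISED SELF-ADAPTATION IS EXACT**: with the flow sampler's `π`-exact sections, the retrain-then-sample sweep leaves
`(p_H·λ_H) ⊗ π` invariant. [ours] -/
theorem metropolisedRetraining_sweep_invariant [SFinite π] (hpH : Measurable pH) (hpH0 : ∀ h, 0 < pH h)
    (hg : Measurable (Function.uncurry g)) (hg0 : ∀ z h', 0 < g z h') (τ : Kernel (Ω × H) H) [IsMarkovKernel τ]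
    (hτ : ∀ (x : Ω) (h : H) {C : Set H}, MeasurableSet C → τ (x, h) C =
      ∫⁻ h' in C, ENNReal.ofReal (g (x, h) h' * min 1 (pH h' * g (x, h') h / (pH h * g (x, h) h'))) ∂lamH +
        (1 - ∫⁻ h', ENNReal.ofReal (g (x, h) h' * min 1 (pH h' * g (x, h') h / (pH h * g (x, h) h'))) ∂lamH) * C.indicator 1 h)
    (κ : Kernel (H × Ω) Ω) (hκ : ∀ (h : H) {B : Set Ω}, MeasurableSet B → ∫⁻ x, κ (h, x) B ∂π = π B)
    (T₁ T₂ : Kernel (H × Ω) (H × Ω))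
    (hT₁ : ∀ (h : H) (x : Ω) {E : Set (H × Ω)}, MeasurableSet E → T₁ (h, x) E = τ (x, h) ((fun h' => (h', x)) ⁻¹' E))
    (hT₂ : ∀ (h : H) (x : Ω) {E : Set (H × Ω)}, MeasurableSet E → T₂ (h, x) E = κ (h, x) ((fun y => (h, y)) ⁻¹' E)) :
    Kernel.Invariant (T₂ ∘ₖ T₁) ((lamH.withDensity fun h => ENNReal.ofReal (pH h)).prod π) :=
  auxWalker_sweep_invariant τ κ (fun x _ hC => metropolisedRetraining_sections_exact hpH hpH0 hg hg0 τ hτ x hC) hκ T₁ T₂ hT₁ hT₂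

end Metropolised

/-! ## §3 The deterministic fit has no pseudo-prior -/

/-- **A DETERMINISTIC FIT IS `m`-EXACT IFF `m` IS THE POINT MASS AT THE FIT**: `τ(x, ·) = δ_{F(x)}` satisfies the section hypothesis at `x` for a
probability `m` iff `m = δ_{F(x)}`.  So a fit that varies with the configuration admits no pseudo-prior, and the self-tuned samplers of
`SelfTunedFlowChoiceBias` fall outside §1. [ours] -/
theorem deterministicFit_sections_exact_iff [MeasurableSingletonClass H] (m : Measure H) [IsProbabilityMeasure m] (F : Ω → H)
    (τ : Kernel (Ω × H) H) (hτ : ∀ (x : Ω) (h : H) {C : Set H}, MeasurableSet C → τ (x, h) C = Measure.dirac (F x) C) (x : Ω) :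
    (∀ {C : Set H}, MeasurableSet C → ∫⁻ h, τ (x, h) C ∂m = m C) ↔ m = Measure.dirac (F x) := by
  constructor
  · intro h
    ext C hC
    rw [← h hC]
    simp_rw [hτ x _ hC]
    rw [lintegral_const, measure_univ, mul_one]
  · intro hm C hC
    simp_rw [hτ x _ hC]
    rw [lintegral_const, measure_univ, mul_one, hm]

end Summit.Ventures.LatticeQCDFlow.Exactness
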